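import Summits.CriticalPhenomena.Ising3DConformalLimit.Theorems.PrimaryAtInfinityTwoPointPowerLawEta
import Summits.CriticalPhenomena.Ising3DConformalLimit.Theses.CoerciveSharpness
import Summits.CriticalPhenomena.Ising3DConformalLimit.Theses.LatticeSDPCertificates
import HarnessLib

/-!
# Strategist certificates for crux `WindowForcesU4` (item stmt-CriticalPhenomena-5505)

Kernel-checked by-products of the STRATEGY-CENSUS (crux strategist seat
`cstrat-stmt-CriticalPhenomena-5505-b1`, 2026-08-17); sorry-free, over landed theorems only. They back the
§Decomposition and §Negation headings of `Cruxes/WindowForcesU4/STRATEGY-CENSUS.md`: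

* `windowForcesU4_of_0636` — the crux is DOWNSTREAM of crux 0636 (`IsingEuclidUpgradeR4NonGaussian`):
  any line on 0636 closes 5505 (so a line on 5505 must use WINDOW non-trivially or it is an alias).
* `windowForcesU4_of_etaFree` — the ETA-FREE DECOMPOSITION transported to 5505:
  `TwoPointPowerLawEta (5354) → GaussianLimitIsFree (2601) → WindowForcesU4`, and its WINDOW-relative
  form `windowForcesU4_of_etaFree_window` : `(WINDOW → 5354) → (WINDOW → 2601) → WindowForcesU4`.
  Typed and proved; deliberately NOT filed as a `route edit --split` (census §Decomposition: WINDOW is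
  decorative in both children, the children are existing staffed items, and installing it on route
  CoerciveSharpness would make its own K1–K2 cruxes decorative in `closes`).
* `window_twoPointPowerLawEta_of_windowForcesU4` — NEGATION/NECESSITY: any proof of the crux proves
  `WINDOW → TwoPointPowerLawEta` (η > 0 in limit form, item 5354) — by the landed edge-Gaussianity theorem
  (`twoPointPowerLawEta_of_nonGaussian'`). So 5505 is at least as hard as "η_eff < 1/2 at all scales ⇒
  η_limit > 0", and a `Δ = 1/2` non-degenerate limit (automatically Wick at order four) refutes 5505 iff
  WINDOW holds — the GFF₃-type impostor (`G ≍ 1/‖x‖`, WINDOW with ε = 1/2) is consistent with every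
  hypothesis of the crux.
-/

namespace Summit.CriticalPhenomena.Ising3DConformalLimit.Cruxes.WindowForcesU4.StrategistCertificates

open Literature.Probability.LatticeModels Filter Set
open scoped Topology
open Summit.CriticalPhenomena.Ising3DConformalLimit.Theses
open Summit.CriticalPhenomena.Ising3DConformalLimit.MoebiusLimitExistsNegative
  (normalised_hasLimit normalised_nondeg hasNontrivialU4_normalised_iff exists_scaleCovariant_normalised
   isTranslationInvariant_normalised_of_limit)
open Summit.CriticalPhenomena.Ising3DConformalLimit.Theorems.PrimaryAtInfinityTwoPointPowerLawEta
  (twoPointPowerLawEta_iff_half_lt_delta twoPointPowerLawEta_of_nonGaussian')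

/-- **5505 ⇐ 0636.** The crux `WindowForcesU4` (route CoerciveSharpness) from crux 0636, ignoring the window.
[folklore] -/
theorem windowForcesU4_of_0636 (h : IsingEuclidUpgrade.IsingEuclidUpgradeR4NonGaussian) :
    CoerciveSharpness.WindowForcesU4 :=
  fun _ ρ S hρ hlim hnd => h ρ S hρ hlim hnd

open Classical in
/-- **ETA-FREE DECOMPOSITION transported to 5505**: items 5354 (`TwoPointPowerLawEta`, "every non-degenerate
limit has `Δ > 1/2`") and 2601 (`GaussianLimitIsFree`, "a Gaussian non-degenerate limit has `Δ = 1/2`") give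
the crux (same proof as the 0636 factorisation: normalise `S` off `NonCoincident`; 5354 gives `Δ > 1/2`; were
`U₄ ≡ 0`, 2601 would give `Δ = 1/2`). [folklore] -/
theorem windowForcesU4_of_etaFree
    (h₁ : PrimaryAtInfinity.TwoPointPowerLawEta) (h₂ : AnomalousForcesInteraction.GaussianLimitIsFree) :
    CoerciveSharpness.WindowForcesU4 := by
  intro _ ρ S hρ hlim hnd
  have h₁' := twoPointPowerLawEta_iff_half_lt_delta.1 h₁
  have hlim' := normalised_hasLimit hlim
  have hnd' := normalised_nondeg hnd
  have htr' := isTranslationInvariant_normalised_of_limit hlim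
  obtain ⟨Δ, -, hsc'⟩ := exists_scaleCovariant_normalised hρ hlim hnd
  have hΔ : 1 / 2 < Δ := h₁' ρ S Δ hρ hlim hnd hsc'
  by_contra hU4
  have hU4' : ¬ HasNontrivialU4 (fun n x => if x ∈ NonCoincident 3 n then S n x else 0) :=
    fun h => hU4 (hasNontrivialU4_normalised_iff.1 h)
  have hhalf : Δ = 1 / 2 := h₂ ρ Δ _ hρ hlim' hnd' htr' hsc' hU4'
  exact absurd hΔ (by rw [hhalf]; exact lt_irrefl _)

/-- **WINDOW-relative form of the eta-free decomposition** (the typed split of census §Decomposition, NOT filed):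
`(WINDOW → 5354) → (WINDOW → 2601) → WindowForcesU4`. [folklore] -/
theorem windowForcesU4_of_etaFree_window
    (h₁ : LatticeSDPCertificates.WindowBelowHalf → PrimaryAtInfinity.TwoPointPowerLawEta)
    (h₂ : LatticeSDPCertificates.WindowBelowHalf → AnomalousForcesInteraction.GaussianLimitIsFree) :
    CoerciveSharpness.WindowForcesU4 :=
  fun hW => windowForcesU4_of_etaFree (h₁ hW) (h₂ hW) hW

/-- **NECESSITY (census §Negation): any proof of the crux proves `WINDOW → η > 0 in limit form` (item 5354).**
By the landed edge-Gaussianity theorem (`Δ = 1/2 ⇒ U₄ ≡ 0`, `twoPointPowerLawEta_of_nonGaussian'`).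
[folklore] -/
theorem window_twoPointPowerLawEta_of_windowForcesU4 (h : CoerciveSharpness.WindowForcesU4)
    (hW : LatticeSDPCertificates.WindowBelowHalf) : PrimaryAtInfinity.TwoPointPowerLawEta :=
  twoPointPowerLawEta_of_nonGaussian' fun ρ S hρ hlim hnd => h hW ρ S hρ hlim hnd

/-- The two route copies of the shared decl are the same statement. [folklore] -/
theorem windowForcesU4_coerciveSharpness_iff_latticeSDP :
    CoerciveSharpness.WindowForcesU4 ↔ LatticeSDPCertificates.WindowForcesU4 := Iff.rfl

end Summit.CriticalPhenomena.Ising3DConformalLimit.Cruxes.WindowForcesU4.StrategistCertificates
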